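import Summits.CriticalPhenomena.PercolationContinuityZ3.Theorems.PercNearOneGluingNoHeavyLowerTailMajorityGluingZThirteenEightHG1C5
import Summits.CriticalPhenomena.PercolationContinuityZ3.Theorems.PercNearOneGluingNoHeavyLowerTailMajorityGluingZThirteenEightHG2C5
import Summits.CriticalPhenomena.PercolationContinuityZ3.Theorems.PercNearOneGluingNoHeavyLowerTailMajorityGluingZThirteenEightHG3C5
import Summits.CriticalPhenomena.PercolationContinuityZ3.Theorems.PercNearOneGluingNoHeavyLowerTailMajorityGluingZThirteenEightHG4C5
import Summits.CriticalPhenomena.PercolationContinuityZ3.Theorems.PercNearOneGluingNoHeavyLowerTailMajorityGluingZRangeAM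
import HarnessLib

/-!
# Key range 5 of 6 of the `(13,8)` certificate at `c = 11/8`: the merged group chunks pass the run check (lane prim-rate, constants-miner 1, gen 39; cert/mkhier.py)

Support file for the closed crux `NoHeavyLowerTail` (stmt-CriticalPhenomena-4575), majority-gluing line.  The range-5 chunks of the 4 group digests are combined by a binary tree
of aggregated merges and run-checked by the kernel; hence their total value is nonnegative at every nonnegative key valuation (`thirteenEightT2R5_nonneg`).  No sorries.
[cite: VandenbergKahn2001, Thm 1.2 (p. 123)]
-/

namespace Summit.CriticalPhenomena.PercolationContinuityZ3.Theorems

namespace HubOnly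
namespace QCert

/-- The aggregate-merge tree of the range-5 chunks. -/
def thirteenEightT2R5T : List (ℕ × ℤ) :=
  am (am (thirteenEightT2G1C5) (thirteenEightT2G2C5)) (am (thirteenEightT2G3C5) (thirteenEightT2G4C5))

set_option maxRecDepth 8192 in
set_option maxHeartbeats 0 in
/-- **The range-5 tree passes the run check** (kernel evaluation). -/
theorem thirteenEightT2R5_runs : runsOK thirteenEightT2R5T = true := by
  decide +kernel

/-- The tree's value is the value of the chunks. -/
theorem thirteenEightT2R5_treeVal (val : ℕ → ℝ) : evalC val thirteenEightT2R5T = evalC val [thirteenEightT2G1C5, thirteenEightT2G2C5, thirteenEightT2G3C5, thirteenEightT2G4C5].flatten := by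
  simp only [thirteenEightT2R5T, evalC_am, List.flatten_cons, List.flatten_nil, evalC_append, evalC_nil', add_assoc, add_zero]

/-- **The range-5 chunks of all groups have nonnegative total value** at every nonnegative key valuation. -/
theorem thirteenEightT2R5_nonneg (val : ℕ → ℝ) (hval : ∀ key, 0 ≤ val key) : 0 ≤ evalC val [thirteenEightT2G1C5, thirteenEightT2G2C5, thirteenEightT2G3C5, thirteenEightT2G4C5].flatten := by
  rw [← thirteenEightT2R5_treeVal val]
  exact evalC_nonneg_of_runsOK val hval _ thirteenEightT2R5_runs

end QCert
end HubOnly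

end Summit.CriticalPhenomena.PercolationContinuityZ3.Theorems
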